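import Summits.Ventures.HodgeRepro2.T5SU11JacobiOrbitRotationLaw
import Summits.Ventures.HodgeRepro2.T5SU11KProjection
import Summits.Ventures.HodgeRepro2.T5BergmanCoefficientVanish

/-!
# The `K`-component is Haar-distributed and independent of the orbit point: `(orbit, kProj)_* ν = poincare ⊗ μ_K`,
and under `m_k φ_λ dν` the `K`-part has the law `dk` independently of `(log|a|, g·0)`

The fibration `Φ(z, u) = s(z) · rot u` of `T5SU11Fibration` has the inverse `g ↦ (g·0, kProj g)` on the disc
(`T5SU11KProjection.eq_sec_orbit_mul_rot_kProj`; `kProj (Φ(z, u)) = u`, `kProj_fib`), and `ν = Φ_* (poincare ⊗ μ_K)`.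
Hence the pair (orbit point, `K`-component) pushes the Haar measure to the PRODUCT measure,

  **`(g ↦ (g·0, kProj g))_* ν = poincare ⊗ μ_K`**   (`map_orbit_kProj_nu`; `kProj` is continuous, `continuous_kProj`),

i.e. for all measurable `Φ : 𝔻 → ℝ`, `Ψ : K → ℝ` (no integrability needed — Bochner integrals of
non-integrable functions vanish on both sides),

  **`∫_G Φ(g·0) Ψ(kProj g) dν = (∫_𝔻 Φ dpoincare) · (∫_K Ψ dμ_K)`**   (`integral_orbit_mul_kProj`).

The Jacobi density `m_k φ_λ` is a function of the orbit point alone (`φ_λ` is right-`K`-invariant: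
`jacobi_density_eq_orbit`), so under the probability measure `m_k φ_λ dν / m̂_k(λ)` of the explicit model, for every
`(k, λ)` on the ray:

* **the `K`-component has the law `dk`** (the normalised Haar measure of `K`): `⟨Ψ(kProj g)⟩_{k,λ} = ∫_K Ψ dk`
  (`mean_kProj_eq`), and
* **it is independent of the orbit point** — hence of the phase `log|a(g)|`, the orbit radius `|g·0|` and the
  orbit angle, all functions of `g·0`: `⟨Φ(g·0) Ψ(kProj g)⟩_{k,λ} = ⟨Φ(g·0)⟩_{k,λ} · ∫_K Ψ dk`
  (`mean_orbit_mul_kProj_eq`; in set form `prob_orbit_mem_and_kProj_mem`).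

Together with `T5SU11JacobiOrbitAngleLaw` (the orbit angle uniform and independent of the radius) this is the
joint law of the three `KAK`-type coordinates (orbit radius, orbit angle, `K`-component) of the explicit model:
radial law ⊗ uniform ⊗ uniform. Nothing is claimed about (N).

Blind lane: Mathlib + the HodgeRepro2 prefix only; no sorry; axioms ⊆ {propext, Classical.choice,
Quot.sound}.
-/

namespace Summit.Ventures.HodgeRepro2.T5SU11JacobiKPartLaw

open MeasureTheory MeasureTheory.Measure Metric Set Filter Topology Complex
open T5PoincareDensity T5PoincareMeasure T5SU11Unimodular T5SU11Fibration T5SU11FibrationHaar T5SU11Cartan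
  T5HaarCircle T5BergmanCoefficient T5SU11KProjection T5SU11OrbitMeasure T5SU11SphericalFunction
  T5SU11SphericalContinuous T5SU11JacobiWeight T5SU11KFiniteMajorantPow T5SU11JacobiOrbitRotationLaw
  T5BergmanCoefficientVanish T5SU11CoeffSqCartan
open scoped Real

/-! ### Continuity of the `K`-projection -/

/-- **`kProj` is continuous**: `kProj g = g₀₀/|g₀₀|` and `g₀₀ ≠ 0`. -/
theorem continuous_kProj : Continuous kProj := by
  have hne : ∀ g : SU11, mat g 0 0 ≠ 0 := mat_zero_zero_ne_zero
  have hc : Continuous fun g : SU11 => mat g 0 0 / (‖mat g 0 0‖ : ℂ) :=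
    (continuous_mat_apply 0 0).div₀ (Complex.continuous_ofReal.comp (continuous_mat_apply 0 0).norm)
      fun g => by exact_mod_cast norm_ne_zero_iff.mpr (hne g)
  have e : kProj = fun g : SU11 => (⟨mat g 0 0 / ‖mat g 0 0‖, mem_sphere_zero_iff_norm.mpr (by
      rw [norm_div, Complex.norm_real, Real.norm_eq_abs, abs_of_pos (norm_pos_iff.mpr (hne g)),
        div_self (norm_ne_zero_iff.mpr (hne g))])⟩ : Circle) := by
    funext g
    unfold kProj phase
    rw [dif_neg (hne g)]
  rw [e]
  exact hc.subtype_mk _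

/-- `kProj (Φ(z, u)) = u`: the `K`-component of the fibration coordinates is the second coordinate. -/
theorem kProj_fib (z : ℂ) (u : Circle) : kProj (fib (z, u)) = u := by
  rw [fib_apply, kProj_mul_rot, kProj_sec, one_mul]

section measure

variable [MeasurableSpace Circle] [BorelSpace Circle]

/-- `kProj` is measurable. -/
theorem measurable_kProj : Measurable kProj := continuous_kProj.measurable

omit [BorelSpace Circle] in
/-- `m_k φ_λ (g) = (1 − |g·0|²)^{k/2} φ_λ(s(g·0))`: the Jacobi density is a function of the orbit point alone
(`φ_λ` is right-`K`-invariant). -/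
theorem jacobi_density_eq_orbit (k lam : ℝ) (g : SU11) :
    (1 - ‖orbit g‖ ^ 2) ^ (k / 2) * sph lam g
      = (1 - ‖orbit g‖ ^ 2) ^ (k / 2) * sph lam (sec (orbit g)) := by
  have hs : sph lam g = sph lam (sec (orbit g)) := by
    conv_lhs => rw [eq_sec_orbit_mul_rot_kProj g]
    rw [sph_mul_rot]
  rw [hs]

variable (μC : Measure Circle) [IsHaarMeasure μC]

omit [BorelSpace Circle] in
/-- `(orbit, kProj) ∘ Φ = id` almost everywhere for `poincare ⊗ μ_K`. -/
lemma orbit_kProj_comp_fib_ae_eq_id :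
    ((fun g : SU11 => (orbit g, kProj g)) ∘ fib) =ᵐ[poincare.prod μC] id := by
  filter_upwards [orbit_comp_fib_ae_eq_fst μC] with p hp
  simp only [Function.comp_apply, id_eq] at hp ⊢
  refine Prod.ext hp ?_
  simp only
  rw [show fib p = fib (p.1, p.2) from rfl, kProj_fib]

/-- **THE ORBIT POINT AND THE `K`-COMPONENT PUSH THE HAAR MEASURE TO THE PRODUCT MEASURE**:
`(g ↦ (g·0, kProj g))_* ν = poincare ⊗ μ_K`. -/
theorem map_orbit_kProj_nu :
    Measure.map (fun g : SU11 => (orbit g, kProj g)) (nu μC) = poincare.prod μC := by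
  rw [show nu μC = Measure.map fib (poincare.prod μC) from rfl,
    Measure.map_map (continuous_orbit.measurable.prodMk measurable_kProj) measurable_fib,
    Measure.map_congr (orbit_kProj_comp_fib_ae_eq_id μC), Measure.map_id]

/-- **THE PRODUCT FORMULA**: for measurable `Φ : ℂ → ℝ`, `Ψ : K → ℝ`,
`∫_G Φ(g·0) Ψ(kProj g) dν = (∫_𝔻 Φ dpoincare) (∫_K Ψ dμ_K)` — the orbit point and the `K`-component are
independent under the Haar measure, with laws `poincare` and `μ_K`. -/
theorem integral_orbit_mul_kProj {Φ : ℂ → ℝ} {Ψ : Circle → ℝ} (hΦ : Measurable Φ) (hΨ : Measurable Ψ) :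
    ∫ g, Φ (orbit g) * Ψ (kProj g) ∂(nu μC) = (∫ z, Φ z ∂poincare) * ∫ u, Ψ u ∂μC := by
  have hm : AEMeasurable (fun g : SU11 => (orbit g, kProj g)) (nu μC) :=
    (continuous_orbit.measurable.prodMk measurable_kProj).aemeasurable
  have hf : AEStronglyMeasurable (fun p : ℂ × Circle => Φ p.1 * Ψ p.2)
      (Measure.map (fun g : SU11 => (orbit g, kProj g)) (nu μC)) :=
    ((hΦ.comp measurable_fst).mul (hΨ.comp measurable_snd)).aestronglyMeasurable
  have h := integral_map hm hf
  simp only at h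
  rw [← h, map_orbit_kProj_nu]
  exact integral_prod_mul Φ Ψ

/-! ### The Jacobi density is a function of the orbit point -/

/-- The density on the disc `z ↦ (1 − |z|²)^{k/2} φ_λ(s(z))` is measurable. -/
theorem measurable_jacobi_disc_density (k lam : ℝ) :
    Measurable fun z : ℂ => (1 - ‖z‖ ^ 2) ^ (k / 2) * sph lam (sec z) :=
  ((measurable_const.sub (measurable_norm.pow_const 2)).pow_const (k / 2)).mul
    ((continuous_sph lam).measurable.comp measurable_sec)

/-- **The product formula for the Jacobi density**: for measurable `Φ : ℂ → ℝ`, `Ψ : K → ℝ`,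
`∫_G Φ(g·0) m_k φ_λ(g) Ψ(kProj g) dν = (∫_𝔻 Φ(z) (1 − |z|²)^{k/2} φ_λ(s(z)) dpoincare) (∫_K Ψ dμ_K)`. -/
theorem integral_orbit_mul_jacobi_mul_kProj (k lam : ℝ) {Φ : ℂ → ℝ} {Ψ : Circle → ℝ} (hΦ : Measurable Φ)
    (hΨ : Measurable Ψ) :
    ∫ g, Φ (orbit g) * ((1 - ‖orbit g‖ ^ 2) ^ (k / 2) * sph lam g) * Ψ (kProj g) ∂(nu μC)
      = (∫ z, Φ z * ((1 - ‖z‖ ^ 2) ^ (k / 2) * sph lam (sec z)) ∂poincare) * ∫ u, Ψ u ∂μC := by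
  have h := integral_orbit_mul_kProj μC (Φ := fun z => Φ z * ((1 - ‖z‖ ^ 2) ^ (k / 2) * sph lam (sec z)))
    (Ψ := Ψ) (hΦ.mul (measurable_jacobi_disc_density k lam)) hΨ
  rw [← h]
  refine integral_congr_ae (Filter.Eventually.of_forall fun g => ?_)
  simp only
  rw [jacobi_density_eq_orbit k lam g]

/-- The marginal: `∫_G Φ(g·0) m_k φ_λ(g) dν = (∫_𝔻 Φ(z) (1 − |z|²)^{k/2} φ_λ(s(z)) dpoincare) · μ_K(K)`. -/
theorem integral_orbit_mul_jacobi (k lam : ℝ) {Φ : ℂ → ℝ} (hΦ : Measurable Φ) :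
    ∫ g, Φ (orbit g) * ((1 - ‖orbit g‖ ^ 2) ^ (k / 2) * sph lam g) ∂(nu μC)
      = (∫ z, Φ z * ((1 - ‖z‖ ^ 2) ^ (k / 2) * sph lam (sec z)) ∂poincare) * (μC Set.univ).toReal := by
  have h := integral_orbit_mul_jacobi_mul_kProj μC k lam (Ψ := fun _ => (1 : ℝ)) hΦ measurable_const
  simp only [mul_one, integral_const, smul_eq_mul, measureReal_def] at h
  exact h

/-! ### The law of the `K`-component under the explicit model -/

/-- **THE `K`-COMPONENT IS INDEPENDENT OF THE ORBIT POINT UNDER `m_k φ_λ dν`**: for measurable `Φ`, `Ψ`,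
`∫_G Φ(g·0) m_k φ_λ Ψ(kProj g) dν = (∫_G Φ(g·0) m_k φ_λ dν) · ∫_K Ψ dk` (`dk` the normalised Haar measure). -/
theorem integral_orbit_mul_jacobi_mul_kProj_haar (k lam : ℝ) {Φ : ℂ → ℝ} {Ψ : Circle → ℝ} (hΦ : Measurable Φ)
    (hΨ : Measurable Ψ) :
    ∫ g, Φ (orbit g) * ((1 - ‖orbit g‖ ^ 2) ^ (k / 2) * sph lam g) * Ψ (kProj g) ∂(nu haarCircle)
      = (∫ g, Φ (orbit g) * ((1 - ‖orbit g‖ ^ 2) ^ (k / 2) * sph lam g) ∂(nu haarCircle))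
        * ∫ u, Ψ u ∂haarCircle := by
  rw [integral_orbit_mul_jacobi_mul_kProj haarCircle k lam hΦ hΨ, integral_orbit_mul_jacobi haarCircle k lam hΦ,
    haarCircle_univ, ENNReal.toReal_one, mul_one]

/-- **THE MEAN OF A FUNCTION OF THE `K`-COMPONENT IS ITS HAAR MEAN**: on the ray,
`⟨Ψ(kProj g)⟩_{k,λ} = ∫_K Ψ dk`. -/
theorem mean_kProj_eq {k lam : ℝ} (hk : 1 < k) (h1 : lam < k) (h2 : 2 < k + lam) {Ψ : Circle → ℝ}
    (hΨ : Measurable Ψ) :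
    (∫ g, Ψ (kProj g) * ((1 - ‖orbit g‖ ^ 2) ^ (k / 2) * sph lam g) ∂(nu haarCircle))
        / (∫ g, (1 - ‖orbit g‖ ^ 2) ^ (k / 2) * sph lam g ∂(nu haarCircle))
      = ∫ u, Ψ u ∂haarCircle := by
  have hpos := jacobi_pos hk h1 h2
  have h := integral_orbit_mul_jacobi_mul_kProj_haar k lam (Φ := fun _ => (1 : ℝ)) measurable_const hΨ
  simp only [one_mul] at h
  have e : ∫ g, Ψ (kProj g) * ((1 - ‖orbit g‖ ^ 2) ^ (k / 2) * sph lam g) ∂(nu haarCircle)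
      = ∫ g, ((1 - ‖orbit g‖ ^ 2) ^ (k / 2) * sph lam g) * Ψ (kProj g) ∂(nu haarCircle) :=
    integral_congr_ae (Filter.Eventually.of_forall fun g => mul_comm _ _)
  rw [div_eq_iff hpos.ne', e, h]
  ring

/-- **INDEPENDENCE, MEAN FORM**: on the ray, for measurable `Φ`, `Ψ`,
`⟨Φ(g·0) Ψ(kProj g)⟩_{k,λ} = ⟨Φ(g·0)⟩_{k,λ} · ∫_K Ψ dk`. -/
theorem mean_orbit_mul_kProj_eq {k lam : ℝ} (hk : 1 < k) (h1 : lam < k) (h2 : 2 < k + lam) {Φ : ℂ → ℝ}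
    {Ψ : Circle → ℝ} (hΦ : Measurable Φ) (hΨ : Measurable Ψ) :
    (∫ g, Φ (orbit g) * Ψ (kProj g) * ((1 - ‖orbit g‖ ^ 2) ^ (k / 2) * sph lam g) ∂(nu haarCircle))
        / (∫ g, (1 - ‖orbit g‖ ^ 2) ^ (k / 2) * sph lam g ∂(nu haarCircle))
      = ((∫ g, Φ (orbit g) * ((1 - ‖orbit g‖ ^ 2) ^ (k / 2) * sph lam g) ∂(nu haarCircle))
          / (∫ g, (1 - ‖orbit g‖ ^ 2) ^ (k / 2) * sph lam g ∂(nu haarCircle)))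
        * ∫ u, Ψ u ∂haarCircle := by
  have hpos := jacobi_pos hk h1 h2
  have h := integral_orbit_mul_jacobi_mul_kProj_haar k lam hΦ hΨ
  have e : ∫ g, Φ (orbit g) * Ψ (kProj g) * ((1 - ‖orbit g‖ ^ 2) ^ (k / 2) * sph lam g) ∂(nu haarCircle)
      = ∫ g, Φ (orbit g) * ((1 - ‖orbit g‖ ^ 2) ^ (k / 2) * sph lam g) * Ψ (kProj g) ∂(nu haarCircle) :=
    integral_congr_ae (Filter.Eventually.of_forall fun g => by ring)
  rw [e, h]
  ring

/-- **INDEPENDENCE, SET FORM**: on the ray, for measurable `A ⊂ ℂ`, `B ⊂ K`,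
`P_{k,λ}(g·0 ∈ A ∧ kProj g ∈ B) = P_{k,λ}(g·0 ∈ A) · dk(B)`. -/
theorem prob_orbit_mem_and_kProj_mem {k lam : ℝ} (hk : 1 < k) (h1 : lam < k) (h2 : 2 < k + lam) {A : Set ℂ}
    {B : Set Circle} (hA : MeasurableSet A) (hB : MeasurableSet B) :
    (∫ g, A.indicator (fun _ => (1 : ℝ)) (orbit g) * B.indicator (fun _ => (1 : ℝ)) (kProj g)
          * ((1 - ‖orbit g‖ ^ 2) ^ (k / 2) * sph lam g) ∂(nu haarCircle))
        / (∫ g, (1 - ‖orbit g‖ ^ 2) ^ (k / 2) * sph lam g ∂(nu haarCircle))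
      = ((∫ g, A.indicator (fun _ => (1 : ℝ)) (orbit g) * ((1 - ‖orbit g‖ ^ 2) ^ (k / 2) * sph lam g)
            ∂(nu haarCircle))
          / (∫ g, (1 - ‖orbit g‖ ^ 2) ^ (k / 2) * sph lam g ∂(nu haarCircle)))
        * (haarCircle B).toReal := by
  rw [mean_orbit_mul_kProj_eq hk h1 h2 (measurable_const.indicator hA) (measurable_const.indicator hB),
    integral_indicator_const (1 : ℝ) hB, smul_eq_mul, mul_one, measureReal_def]

end measure

end Summit.Ventures.HodgeRepro2.T5SU11JacobiKPartLaw
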